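import Summits.QuantumFields.YangMills.Theorems.BalabanUVNodesN16EntrySqueezeClassRadius
import Summits.QuantumFields.YangMills.Theorems.BalabanUVNodesN16PinnedLooseMatchSqueezeJunction

/-!
# Route «BalabanUVNodes», crux K3⁸ `SpineGivenEndpointR13SepCoPHV` (stmt-QuantumFields-27366), node N16 = NE3 — THE TOP KNIT, PART (B2): module 53's (β16) PRODUCER WITH THE
# N16 → N19′ JUNCTION ROWS and the junction `hH3 ∧ hsel`, RE-KEYED FROM node N05's ℤᵈ `h5` TO node N16's OWN CHAIN-ENTRY OBJECT `hE` (module 57) — proofs verbatim over module 59a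

Cell `pub-ymgap`, seat `pub-ymgap-dag-n16-e` (R134 acceleration seat (a), strategy s2 = BY-NAME KNIT at the record; HUMAN RULING D-0062; chair R424 venue), generation 24,
module 59b (THEOREMS ONLY, 0 `def`, 0 `sorry`, standard axioms; Theses-free, importable).  `--kind proof --supports stmt-QuantumFields-27366 --as helper` (count-neutral;
proves NO registered stub).  `bears_on: R4∕N16 · edges N05 → N16, N07 → N16 · junction N16 → N19′ (stub 2) · composite N27`.

WHY (HOME `HANDOFF.md` §g23 «THE TOP KNIT» (b); modules 57 p688434, 58, 59a).  Module 53 (`…N16PinnedLooseMatchSqueezeJunction`, p644122) is the producer every K3⁸ bill's N16 rows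
are fed from (module 54A's adapter re-letters its §2; dag-n19-w3's junction rows `hH3 ∧ hsel` are its §3); it reads node N05 through `h5` (ℤᵈ currency).  THIS MODULE is module 53
§2–§3 with `h5 ↦ hE` (node N16's θ-free chain-entry object «(T4ᵀ_print)_β with one `(c₁′, B, B_h)` ∀ k ≥ 1», served by node N05's Σ-object through module 58 and by the ℤᵈ road
alike) and dag-n16-c's PRINT β-slot for the ℤᵈ leaf slot: statements = module 53's under that substitution (`0 ≤ β` dropped); proofs VERBATIM over module 59a's §2 (the per-family
letters lemma at the loose object) and §0 (slot transport), module 53 §1's scalar lemma `junctionRows_of_lowerBounds` and dag-n16-w4's `hH3_of_… ∕ hsel_of_…` BY NAME.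

WHAT IS PROVED ([folklore] bookkeeping BY NAME; no estimate).  §2 ★★ `exists_letters_n16HolderAtReading_loose_squeezeJunction_of_entry_reg910Slot` · §3 ★★
`exists_letters_hH3_hsel_of_entry_reg910Slot_of_exists8P_locMin`.

HONEST FRAMING.  Bookkeeping BY NAME; no estimate.  `hE` ([Balaban1985RegularSpaces] Thm 4 p. 88 with Prop. 3's letters, Hölder member at exponent `β` AS PRINTED, all-torus
geometry, every depth, ONE threshold), the SLOT KEY (node N07 — [Balaban1985Variational] Thm 1 (9)–(10): `G hGm hG C hR`) and, in §3, node N07's two sentences ((P)-(8), sentence 2)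
are DISPLAYED HYPOTHESES asserted for no family; no stub of K3⁸ v7 is closed or claimed; **N16 ∕ N05 ∕ N06 ∕ N07 ∕ N19′ ∕ N27 NOT discharged**; counts UNMOVED (typed 28∕28 ·
discharged 7∕27 · A 7∕28 — the chair's line is the only count).  One finite four-torus at fixed `ε`, Bałaban AS PRINTED — NOT ℝ⁴, NOT infinite volume, NOT OS, NOT a mass gap;
the Yang–Mills mass gap (Clay) is NOT proved by any of this — R4 closes the conditional finite-𝕋⁴ rung `BalabanLadder.UV` only.
References: [Balaban1985RegularSpaces] T. Bałaban, CMP **99** (1985) 75–102, Thm 4 p. 88, Prop. 3 p. 87; [Balaban1985Variational] T. Bałaban, CMP **102** (1985) 277–309, Thm 1 p. 279.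
-/

set_option autoImplicit false

open scoped BigOperators Matrix Matrix.Norms.L2Operator
open NormedSpace

namespace Summit.QuantumFields.YangMills.BalabanUVNodes.N16EntrySqueezeJunction

open Literature.MathematicalPhysics.QuantumFieldTheory.Balaban1983to89
open Literature.MathematicalPhysics.QuantumFieldTheory.Balaban1983to89.T4Continuum (T4Family ULoop)
open B7Prop1Explicit B7Prop2Explicit MatrixLog UnitaryModel
open T4AveragingDeficitWall hiding Site Plane Plaq Bond
open B7Eq92Concrete (mgauge)
open B8Ineq132 (covDerivFwd)
open B8Eq184Proof (cfgExp)
open B8Eq119TwistedAxial (Restr129)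
open B8Eq138LandauZd (covLap IsLandau138)
open B8Thm4TorusAt (torusLam Thm4TorusAt)
open Node00 (Stage13HParams NE3Objects₁₁ NE3Letters₁₁ ne3ConstLayerOfRecord₁₁ ne3NperOfRecord₁₁ ne3DomOfRecord₁₁ MatA)
open Summit.QuantumFields.BalabanUV.T4Continuum
open MinimalActionSandwich (IsMinimiser admissible)
open MinimalActionLevels (levelAction)
open MinimalActionRate (sfClass)
open MinimalActionRefine (RegularSup gradConst)
open MinimalActionDictionary (torusVP RadiiMono)
open NE3.LeafIndexSockets (LeafH3sup)
open NE3EnergyShapes (IsUnitarySite IsPeriodicSite)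
open AveragingDeficitLatticeH2Prep (fd)
open B11 (Regularity)
open YMDAG.UVSplit (ne3OfRecord₁₁ RateReading₁₃CoPH rateCarriersOfRecord₁₃CoPH)
open Summit.QuantumFields.YangMills.BalabanUVNodes.N16HolderRegime (PrintSlotHolder InEndRegimeH radiusOfRecordH constOfRecordH n16HolderAt_of_inEndRegimeH_printSlotHolder)
open Summit.QuantumFields.YangMills.BalabanUVNodes.N16H7LooseOfReg910Slot (leafH3sup_loose_of_reg910Slot)
open Summit.QuantumFields.YangMills.BalabanUVNodes.N16PinnedLayer13CoPH (N16PinnedLoose N16LettersEnd N16HolderAtReading n16HolderAtReading_of_pinnedLoose)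
open Summit.QuantumFields.YangMills.BalabanUVNodes.N16PinnedLooseMatch (n16HolderAt_anti_dom looseDom_anti)
open Summit.QuantumFields.YangMills.BalabanUVNodes.N16 (gradConst_four_pos)
open Summit.QuantumFields.YangMills.BalabanUVNodes.N16PinnedLooseMatchSqueeze (inEndRegimeH_reletter squeezeLetters_spec)
open Summit.QuantumFields.YangMills.BalabanUVNodes.N16PinnedLooseMatchSqueezeJunction (junctionRows_of_lowerBounds)
open Summit.QuantumFields.YangMills.BalabanUVNodes.N16EntrySqueezeClassRadius (printSlotHolder_reletter exists_letters_inEndRegimeH_printSlotHolder_classRadius_of_entry_reg910Slot)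
open Summit.QuantumFields.YangMills.BalabanUVNodes.N16ProducersAtBareLedgerReading (hH3_of_pinnedLoose_of_loose_of_exists8P_locMin
  hsel_of_pinnedLoose_of_loose_of_exists8P)

noncomputable section

variable {N : ℕ} [NeZero N] {β : ℝ}

/-! ## §2 ★★ The producer with the junction rows: module 50's construction at the enlarged radius letter, plus the loose leaf from the slot key -/

section Producer

variable (hβ1 : β ≤ 1)
include hβ1

/-- **★★ THE PRODUCER OF THE THREE N16 CONJUNCTS WITH NODE N19′'s COMPLETE N16-LETTER BLOCK AND THE N16 → N19′ JUNCTION ROWS** — from node N16's chain-entry object `hE`, a local-gauge shape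
`G F` monotone in its radii with the (9)_{β₀=1} interface, constants `C F`, and the SLOT KEY `hR` (module 47∕49∕50's binders): letters `ℓ₃` (module 49's: `(ℓ₃ F).b := c' F`,
`(ℓ₃ F).g := gradConst 4 (c' F)`), the sup letter `c' F := min (ε∕(2^76·L^12)) (1∕(2^91·L^17))`, and the ENLARGED radius letter
`B F := max (max (C F).B₃ (4ε∕c' F)) (max (16937·(C F).B₃·ε∕c' F) (max (ε∕(C F).a₁) (28·(C F).B₃·ε)))` (`ε := (ℓ₃ F).ε`), with: `N16LettersEnd N (gradConst 4 ∘ c') ℓ₃`; the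
MATCH row; `(C F).B₃ ≤ B F ∧ 2^78·L^12 ≤ B F`; node N19′'s ten-row N16-letter block (module 50's, VERBATIM); the N16 conjunct at every reading pinned loose at `ℓ₃, B`; the
LOOSE LEAF `LeafH3sup 4 F.L Nper (ρ F) (ρ F) (16937·ρ F) D_F` at `ρ F := (C F).B₃·((ℓ₃ F).ε ∕ B F)` on the pinned loose data (dag-n16-w1's `leafH3sup_loose_of_reg910Slot` at
`ε := ρ F`, whose data cut `ρ F ∕ (C F).B₃` IS `(ℓ₃ F).ε ∕ B F`); and the junction scalar rows `0 < ρ F`, `ρ F ≤ (ℓ₃ F).ε`, `ρ F ≤ (ℓ₃ F).b`, `16937·ρ F ≤ c' F`,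
`ρ F ≤ (C F).B₃·(C F).a₁`, `ρ F ≤ 1∕28`. [cite: Balaban1985Variational, Thm 1 (9)–(10) p.279] [folklore] -/
theorem exists_letters_n16HolderAtReading_loose_squeezeJunction_of_entry_reg910Slot
    (hE : ∀ F : T4Family, ∃ B Bh c₁' : ℝ, 0 < B ∧ 0 < c₁' ∧ 16 * (B * c₁') ≤ 1 ∧
      ∀ k, 1 ≤ k → Thm4TorusAt F.L k (((ne3NperOfRecord₁₁ F 0 0 * F.L ^ k : ℕ) : ℤ)) (((F.L : ℝ) ^ k)⁻¹) c₁' (unitaryUnits (Matrix (Fin N) (Fin N) ℂ))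
        (fun _ => True) (Restr129 F.L k (torusLam k))
        (fun (α₀ α₁ : ℝ) (U₀ U' : Site 4 → Fin 4 → (Matrix (Fin N) (Fin N) ℂ)ˣ) (u : Site 4 → (Matrix (Fin N) (Fin N) ℂ)ˣ) =>
          ∃ A : Site 4 → Fin 4 → Matrix (Fin N) (Fin N) ℂ,
            (∀ x μ, IsSelfAdjoint (A x μ)) ∧ (∀ (x : Site 4) (κ μ : Fin 4), A (x + (((ne3NperOfRecord₁₁ F 0 0 * F.L ^ k : ℕ) : ℤ)) • e κ) μ = A x μ) ∧
            mgauge U₀ u (cfgExp (((F.L : ℝ) ^ k)⁻¹) A) = U' ∧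
            (∀ x μ, ‖A x μ‖ ≤ B * (α₀ + α₁)) ∧
            (∀ (μ : Fin 4) (x : Site 4) (κ : Fin 4), ‖covDerivFwd (((F.L : ℝ) ^ k)⁻¹) U₀ μ (fun z => A z κ) x‖ ≤ B * (α₀ + α₁)) ∧
            IsLandau138 F.L k (((F.L : ℝ) ^ k)⁻¹) Set.univ (torusLam k) U₀ A ∧
            (∀ (μ : Fin 4) (y : Site 4) (κ : Fin 4),
              ‖Ad (U₀ y μ) (covDerivFwd (((F.L : ℝ) ^ k)⁻¹) U₀ μ (fun z => A z κ) (y + e μ)) - covDerivFwd (((F.L : ℝ) ^ k)⁻¹) U₀ μ (fun z => A z κ) y‖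
                ≤ Bh * (α₀ + α₁) * (((F.L : ℝ)⁻¹) ^ k) ^ β) ∧
            (∀ (x : Site 4) (κ : Fin 4), ‖covLap (((F.L : ℝ) ^ k)⁻¹) U₀ (fun z => A z κ) x‖ ≤ B * (α₀ + α₁))))
    {G : T4Family → (Site 4 → Fin 4 → (MatA N)ˣ) → Site 4 → ℕ → ℝ → ℝ → ℝ → Prop} (hGm : ∀ F, RadiiMono 4 (G F))
    (hG : ∀ (F : T4Family) (U : Site 4 → Fin 4 → (MatA N)ˣ) (x : Site 4) (K : ℕ) (α₀ α₁ α₂ : ℝ), 2 ≤ K → G F U x K α₀ α₁ α₂ →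
      ∃ (u : Site 4 → (MatA N)ˣ) (a : Site 4 → Fin 4 → MatA N),
        (∀ z, u z ∈ unitaryUnits (MatA N)) ∧
        (∀ (y : Site 4) (τ : Fin 4), l1 (y - x) ≤ 2 → ((gaugeAct u U y τ : (MatA N)ˣ) : MatA N) = exp (a y τ)) ∧
        (∀ (y : Site 4) (τ : Fin 4), l1 (y - x) ≤ 2 → ‖a y τ‖ ≤ α₀) ∧
        (∀ (y : Site 4) (τ i : Fin 4), l1 (y - x) ≤ 1 → ‖fd i (fun z => a z τ) y‖ ≤ α₁) ∧
        (∀ (τ i l : Fin 4), ‖fd i (fd l (fun z => a z τ)) x‖ ≤ α₂))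
    (C : T4Family → B11Thm1.Consts)
    (hR : ∀ (F : T4Family) (k : ℕ) (ε₁ : ℝ), 0 < ε₁ → ε₁ ≤ (C F).a₁ → ∀ (V U : Site 4 → Fin 4 → (MatA N)ˣ), V ∈ sfClass 4 F.L (ne3NperOfRecord₁₁ F 0 0) ε₁ 0 →
      IsMinimiser 4 (sfClass 4 F.L (ne3NperOfRecord₁₁ F 0 0) ((C F).B₃ * ε₁)) F.L (ne3NperOfRecord₁₁ F 0 0) (k + 1) V U →
        ∀ x : Site 4, Regularity (torusVP 4 F.L (ne3NperOfRecord₁₁ F 0 0) (G F) (k + 1)) (C F).B₃ (C F).B₄ ε₁ U (x, F.L ^ (k + 1) - 1 + F.L ^ (k + 1) + 2)) :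
    ∃ (ℓ₃ : T4Family → NE3Letters₁₁) (B c' : T4Family → ℝ), N16LettersEnd N (fun F => gradConst 4 (c' F)) ℓ₃ ∧
      (∀ F : T4Family, 0 < B F ∧ (ℓ₃ F).ε / B F ≤ (ℓ₃ F).b) ∧
      (∀ F : T4Family, (C F).B₃ ≤ B F ∧ (2 : ℝ) ^ 78 * (F.L : ℝ) ^ 12 ≤ B F) ∧
      (∀ F : T4Family, (ℓ₃ F).g = gradConst 4 (c' F) ∧ 0 ≤ c' F ∧ 0 < c' F ∧ (ℓ₃ F).b ≤ c' F ∧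
        (2 : ℝ) ^ 91 * (F.L : ℝ) ^ 17 * c' F ≤ 1 ∧ (2 : ℝ) ^ 76 * (F.L : ℝ) ^ 12 * c' F ≤ (ℓ₃ F).ε ∧
        16 * C0 4 * (ℓ₃ F).ε ≤ 3 ∧ 1024 * (4 + 1) * (4 + 4) * (F.L : ℝ) ^ 2 * (ℓ₃ F).ε ≤ 1 ∧
        (ℓ₃ F).ε / B F ≤ 1 / 4 ∧ 4 * ((ℓ₃ F).ε / B F) ≤ c' F) ∧
      (∀ 𝔯 : RateReading₁₃CoPH N, N16PinnedLoose 𝔯 ℓ₃ B → N16HolderAtReading 𝔯 β) ∧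
      (∀ F : T4Family, LeafH3sup 4 F.L (ne3NperOfRecord₁₁ F 0 0) ((C F).B₃ * ((ℓ₃ F).ε / B F)) ((C F).B₃ * ((ℓ₃ F).ε / B F))
        (16937 * ((C F).B₃ * ((ℓ₃ F).ε / B F)))
        ({V | V ∈ ne3DomOfRecord₁₁ F N 0 0 ∧ V ∈ sfClass 4 F.L (ne3NperOfRecord₁₁ F 0 0) ((ℓ₃ F).ε / B F) 0} : Set (Site 4 → Fin 4 → (MatA N)ˣ))) ∧
      (∀ F : T4Family, 0 < (C F).B₃ * ((ℓ₃ F).ε / B F) ∧ (C F).B₃ * ((ℓ₃ F).ε / B F) ≤ (ℓ₃ F).ε ∧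
        (C F).B₃ * ((ℓ₃ F).ε / B F) ≤ (ℓ₃ F).b ∧ 16937 * ((C F).B₃ * ((ℓ₃ F).ε / B F)) ≤ c' F ∧
        (C F).B₃ * ((ℓ₃ F).ε / B F) ≤ (C F).B₃ * (C F).a₁ ∧ (C F).B₃ * ((ℓ₃ F).ε / B F) ≤ 1 / 28) := by
  -- the letters of record at the loose object of radius `ε ∕ B₃`, from `hE` and the slot key, at the auxiliary coupling letter `1`, with the class-radius rows (module 50 §2)
  choose ℓ hℓ using fun F => exists_letters_inEndRegimeH_printSlotHolder_classRadius_of_entry_reg910Slot (N := N) F one_pos (hE F) (hGm F) (hG F) (C F) (hR F)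
  have hε0 : ∀ F, 0 < (ℓ F).ε := fun F => (hℓ F).2.2.2.2.2.2.2.2.1.2.2.2.1
  have hL1 : ∀ F : T4Family, (1 : ℝ) ≤ F.L := fun F => by exact_mod_cast le_trans one_le_two (HistoryFlow.two_le_L F)
  have hL1n : ∀ F : T4Family, 1 ≤ F.L := fun F => le_trans one_le_two (HistoryFlow.two_le_L F)
  -- the squeezed sup letter per family (module 49) and the ENLARGED radius letter
  obtain ⟨c'f, hc'f⟩ : ∃ c'f : T4Family → ℝ, c'f = fun F => min ((ℓ F).ε / ((2 : ℝ) ^ 76 * (F.L : ℝ) ^ 12)) (1 / ((2 : ℝ) ^ 91 * (F.L : ℝ) ^ 17)) := ⟨_, rfl⟩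
  have hs : ∀ F, 0 < c'f F ∧ (2 : ℝ) ^ 91 * (F.L : ℝ) ^ 17 * c'f F ≤ 1 ∧ (2 : ℝ) ^ 76 * (F.L : ℝ) ^ 12 * c'f F ≤ (ℓ F).ε ∧ c'f F ≤ (ℓ F).ε / 2 ∧
      512 * (4 + 1) * (4 + 4) * (F.L : ℝ) ^ 2 * c'f F ≤ 1 := fun F => by
    subst hc'f
    obtain ⟨h1, h2, h3, h4, h5', -⟩ := squeezeLetters_spec (hL1 F) (hε0 F) (C F).B₃_pos
    exact ⟨h1, h2, h3, h4, h5'⟩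
  obtain ⟨Bf, hBf⟩ : ∃ Bf : T4Family → ℝ, Bf = fun F => max (max (C F).B₃ (4 * (ℓ F).ε / c'f F))
      (max (16937 * (C F).B₃ * (ℓ F).ε / c'f F) (max ((ℓ F).ε / (C F).a₁) (28 * (C F).B₃ * (ℓ F).ε))) := ⟨_, rfl⟩
  have hJ : ∀ F, (0 < Bf F ∧ (C F).B₃ ≤ Bf F ∧ (ℓ F).ε / Bf F ≤ c'f F ∧ (ℓ F).ε / Bf F ≤ 1 / 4 ∧ 4 * ((ℓ F).ε / Bf F) ≤ c'f F ∧
      (2 : ℝ) ^ 78 * (F.L : ℝ) ^ 12 ≤ Bf F) ∧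
      (0 < (C F).B₃ * ((ℓ F).ε / Bf F) ∧ (C F).B₃ * ((ℓ F).ε / Bf F) ≤ (ℓ F).ε ∧ (C F).B₃ * ((ℓ F).ε / Bf F) ≤ c'f F ∧
        16937 * ((C F).B₃ * ((ℓ F).ε / Bf F)) ≤ c'f F ∧ (C F).B₃ * ((ℓ F).ε / Bf F) ≤ (C F).B₃ * (C F).a₁ ∧ (C F).B₃ * ((ℓ F).ε / Bf F) ≤ 1 / 28) := fun F => by
    subst hBf
    exact junctionRows_of_lowerBounds (hL1 F) (hε0 F) (C F).B₃_pos (C F).a₁_pos (hs F).1 (hs F).2.1 (hs F).2.2.1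
      (le_max_of_le_left (le_max_left _ _)) (le_max_of_le_left (le_max_right _ _)) (le_max_of_le_right (le_max_left _ _))
      (le_max_of_le_right (le_max_of_le_right (le_max_left _ _))) (le_max_of_le_right (le_max_of_le_right (le_max_right _ _)))
  -- the loose leaf from the slot key at `ρ := B₃·(ε∕B)` (its data cut `ρ∕B₃` is the pinned loose radius `ε∕B`)
  have hleaf : ∀ F : T4Family, LeafH3sup 4 F.L (ne3NperOfRecord₁₁ F 0 0) ((C F).B₃ * ((ℓ F).ε / Bf F)) ((C F).B₃ * ((ℓ F).ε / Bf F))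
      (16937 * ((C F).B₃ * ((ℓ F).ε / Bf F)))
      ({V | V ∈ ne3DomOfRecord₁₁ F N 0 0 ∧ V ∈ sfClass 4 F.L (ne3NperOfRecord₁₁ F 0 0) ((ℓ F).ε / Bf F) 0} : Set (Site 4 → Fin 4 → (MatA N)ˣ)) := fun F => by
    have hl := leafH3sup_loose_of_reg910Slot (hL1n F) (hGm F) (hG F) (C F) (hR F) (hJ F).2.1 (hJ F).2.2.2.2.2.1 (hJ F).2.2.2.2.2.2
      (ne3DomOfRecord₁₁ F N 0 0)
    rwa [mul_div_cancel_left₀ _ (C F).B₃_pos.ne'] at hl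
  refine ⟨fun F => ⟨(ℓ F).ε, c'f F, gradConst 4 (c'f F), constOfRecordH N F.L (ne3NperOfRecord₁₁ F 0 0) (gradConst 4 (c'f F)), (ℓ F).Λ₁, (ℓ F).Λ₂'⟩, Bf, c'f,
    fun F => ⟨rfl, (hℓ F).2.1, rfl, (hs F).1, (hs F).2.2.2.2, (hℓ F).2.2.2.2.2.1, ?_⟩,
    fun F => ⟨(hJ F).1.1, (hJ F).1.2.2.1⟩, fun F => ⟨(hJ F).1.2.1, (hJ F).1.2.2.2.2.2⟩,
    fun F => ⟨rfl, (hs F).1.le, (hs F).1, le_rfl, (hs F).2.1, (hs F).2.2.1, (hℓ F).2.2.2.2.2.2.1, (hℓ F).2.2.2.2.2.2.2.1,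
      (hJ F).1.2.2.2.1, (hJ F).1.2.2.2.2.1⟩,
    fun 𝔯 hpin => n16HolderAtReading_of_pinnedLoose β hpin fun F => ?_, hleaf,
    fun F => ⟨(hJ F).2.1, (hJ F).2.2.1, (hJ F).2.2.2.1, (hJ F).2.2.2.2.1, (hJ F).2.2.2.2.2.1, (hJ F).2.2.2.2.2.2⟩⟩
  · -- THE END's regime at the re-lettered constant layer (module 49 §1 transport of module 50 §2's `InEndRegimeH`; the regime does not read the data)
    have hreg := inEndRegimeH_reletter F _ (ne3DomOfRecord₁₁ F N 0 0) (hℓ F).2.2.2.2.2.2.2.2.1 (gradConst_four_pos (hs F).1) (hs F).1.le (hs F).2.2.2.1 le_rfl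
    exact hreg
  · -- the N16 conjunct: closer at radius `ε ∕ B₃` on the re-lettered loose object, then antitonicity down to radius `ε ∕ B`
    have hreg := inEndRegimeH_reletter F _ {V | V ∈ ne3DomOfRecord₁₁ F N 0 0 ∧ V ∈ sfClass 4 F.L (ne3NperOfRecord₁₁ F 0 0) ((ℓ F).ε / (C F).B₃) 0}
      (hℓ F).2.2.2.2.2.2.2.2.1 (gradConst_four_pos (hs F).1) (hs F).1.le (hs F).2.2.2.1 le_rfl
    have hH := n16HolderAt_of_inEndRegimeH_printSlotHolder hreg hβ1 (printSlotHolder_reletter F _ _ _ _ (hℓ F).2.2.2.2.2.2.2.2.2)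
    have hres := n16HolderAt_anti_dom F (looseDom_anti F (hε0 F).le (C F).B₃_pos (hJ F).1.2.1) hH
    exact hres

/-! ## §3 ★★ The N16 → N19′ junction from `hE` + the slot key + node N07's two sentences only (§2 ∘ dag-n16-w4 p640452 §2) -/

/-- **★★ THE JUNCTION ROWS `hH3` ∧ `hsel` AT EVERY TUPLE, FROM `hE` + THE SLOT KEY + NODE N07's TWO SENTENCES.**  §2's letters `ℓ₃ B c'` and its first five conjuncts; then
for every top radius `εTop` with `(ℓ₃ F).ε ≤ εTop F`, every (P)-(8) at `(ρ F, εTop F)` on the pinned loose data `D_F` ([Balaban1985Variational] Thm 1 sentence 1 with clause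
(8) read at the problem level) and every Thm 1 sentence 2 at `εTop F` for interior local minimisers (dag-n16-w4 p640452 §2's binder texts VERBATIM at the PRODUCED radius
`ρ F := (C F).B₃·((ℓ₃ F).ε ∕ B F)`), and every reading `𝔯` pinned loose at `(ℓ₃, B)`: dag-n19-w3's rows `hH3` (`LeafH3sup 4 R.ne3.L R.ne3.Nper R.ne3.ε R.ne3.b (c' F)
R.ne3.dom`) and `hsel` (a selection of `R.ne3.ε`-minimisers, `RegularSup 4 R.ne3.L R.ne3.Nper R.ne3.b (c' F)`) at `R := rateCarriersOfRecord₁₃CoPH 𝔯 F θ hP g₀ os k`, every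
tuple and run length — p640452 §2's `hH3_of_pinnedLoose_of_loose_of_exists8P_locMin` ∕ `hsel_of_pinnedLoose_of_loose_of_exists8P` fed with §2's loose leaf and rows (`c F :=
16937·ρ F`).  No N16 letter row is displayed. [cite: Balaban1985Variational, Thm 1 (8)–(10) p.279] [folklore] -/
theorem exists_letters_hH3_hsel_of_entry_reg910Slot_of_exists8P_locMin
    (hE : ∀ F : T4Family, ∃ B Bh c₁' : ℝ, 0 < B ∧ 0 < c₁' ∧ 16 * (B * c₁') ≤ 1 ∧
      ∀ k, 1 ≤ k → Thm4TorusAt F.L k (((ne3NperOfRecord₁₁ F 0 0 * F.L ^ k : ℕ) : ℤ)) (((F.L : ℝ) ^ k)⁻¹) c₁' (unitaryUnits (Matrix (Fin N) (Fin N) ℂ))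
        (fun _ => True) (Restr129 F.L k (torusLam k))
        (fun (α₀ α₁ : ℝ) (U₀ U' : Site 4 → Fin 4 → (Matrix (Fin N) (Fin N) ℂ)ˣ) (u : Site 4 → (Matrix (Fin N) (Fin N) ℂ)ˣ) =>
          ∃ A : Site 4 → Fin 4 → Matrix (Fin N) (Fin N) ℂ,
            (∀ x μ, IsSelfAdjoint (A x μ)) ∧ (∀ (x : Site 4) (κ μ : Fin 4), A (x + (((ne3NperOfRecord₁₁ F 0 0 * F.L ^ k : ℕ) : ℤ)) • e κ) μ = A x μ) ∧
            mgauge U₀ u (cfgExp (((F.L : ℝ) ^ k)⁻¹) A) = U' ∧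
            (∀ x μ, ‖A x μ‖ ≤ B * (α₀ + α₁)) ∧
            (∀ (μ : Fin 4) (x : Site 4) (κ : Fin 4), ‖covDerivFwd (((F.L : ℝ) ^ k)⁻¹) U₀ μ (fun z => A z κ) x‖ ≤ B * (α₀ + α₁)) ∧
            IsLandau138 F.L k (((F.L : ℝ) ^ k)⁻¹) Set.univ (torusLam k) U₀ A ∧
            (∀ (μ : Fin 4) (y : Site 4) (κ : Fin 4),
              ‖Ad (U₀ y μ) (covDerivFwd (((F.L : ℝ) ^ k)⁻¹) U₀ μ (fun z => A z κ) (y + e μ)) - covDerivFwd (((F.L : ℝ) ^ k)⁻¹) U₀ μ (fun z => A z κ) y‖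
                ≤ Bh * (α₀ + α₁) * (((F.L : ℝ)⁻¹) ^ k) ^ β) ∧
            (∀ (x : Site 4) (κ : Fin 4), ‖covLap (((F.L : ℝ) ^ k)⁻¹) U₀ (fun z => A z κ) x‖ ≤ B * (α₀ + α₁))))
    {G : T4Family → (Site 4 → Fin 4 → (MatA N)ˣ) → Site 4 → ℕ → ℝ → ℝ → ℝ → Prop} (hGm : ∀ F, RadiiMono 4 (G F))
    (hG : ∀ (F : T4Family) (U : Site 4 → Fin 4 → (MatA N)ˣ) (x : Site 4) (K : ℕ) (α₀ α₁ α₂ : ℝ), 2 ≤ K → G F U x K α₀ α₁ α₂ →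
      ∃ (u : Site 4 → (MatA N)ˣ) (a : Site 4 → Fin 4 → MatA N),
        (∀ z, u z ∈ unitaryUnits (MatA N)) ∧
        (∀ (y : Site 4) (τ : Fin 4), l1 (y - x) ≤ 2 → ((gaugeAct u U y τ : (MatA N)ˣ) : MatA N) = exp (a y τ)) ∧
        (∀ (y : Site 4) (τ : Fin 4), l1 (y - x) ≤ 2 → ‖a y τ‖ ≤ α₀) ∧
        (∀ (y : Site 4) (τ i : Fin 4), l1 (y - x) ≤ 1 → ‖fd i (fun z => a z τ) y‖ ≤ α₁) ∧
        (∀ (τ i l : Fin 4), ‖fd i (fd l (fun z => a z τ)) x‖ ≤ α₂))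
    (C : T4Family → B11Thm1.Consts)
    (hR : ∀ (F : T4Family) (k : ℕ) (ε₁ : ℝ), 0 < ε₁ → ε₁ ≤ (C F).a₁ → ∀ (V U : Site 4 → Fin 4 → (MatA N)ˣ), V ∈ sfClass 4 F.L (ne3NperOfRecord₁₁ F 0 0) ε₁ 0 →
      IsMinimiser 4 (sfClass 4 F.L (ne3NperOfRecord₁₁ F 0 0) ((C F).B₃ * ε₁)) F.L (ne3NperOfRecord₁₁ F 0 0) (k + 1) V U →
        ∀ x : Site 4, Regularity (torusVP 4 F.L (ne3NperOfRecord₁₁ F 0 0) (G F) (k + 1)) (C F).B₃ (C F).B₄ ε₁ U (x, F.L ^ (k + 1) - 1 + F.L ^ (k + 1) + 2)) :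
    ∃ (ℓ₃ : T4Family → NE3Letters₁₁) (B c' : T4Family → ℝ), N16LettersEnd N (fun F => gradConst 4 (c' F)) ℓ₃ ∧
      (∀ F : T4Family, 0 < B F ∧ (ℓ₃ F).ε / B F ≤ (ℓ₃ F).b) ∧
      (∀ F : T4Family, (C F).B₃ ≤ B F ∧ (2 : ℝ) ^ 78 * (F.L : ℝ) ^ 12 ≤ B F) ∧
      (∀ F : T4Family, (ℓ₃ F).g = gradConst 4 (c' F) ∧ 0 ≤ c' F ∧ 0 < c' F ∧ (ℓ₃ F).b ≤ c' F ∧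
        (2 : ℝ) ^ 91 * (F.L : ℝ) ^ 17 * c' F ≤ 1 ∧ (2 : ℝ) ^ 76 * (F.L : ℝ) ^ 12 * c' F ≤ (ℓ₃ F).ε ∧
        16 * C0 4 * (ℓ₃ F).ε ≤ 3 ∧ 1024 * (4 + 1) * (4 + 4) * (F.L : ℝ) ^ 2 * (ℓ₃ F).ε ≤ 1 ∧
        (ℓ₃ F).ε / B F ≤ 1 / 4 ∧ 4 * ((ℓ₃ F).ε / B F) ≤ c' F) ∧
      (∀ 𝔯 : RateReading₁₃CoPH N, N16PinnedLoose 𝔯 ℓ₃ B → N16HolderAtReading 𝔯 β) ∧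
      ∀ εTop : T4Family → ℝ, (∀ F : T4Family, (ℓ₃ F).ε ≤ εTop F) →
        (∀ (F : T4Family), ∀ V ∈ ({V | V ∈ ne3DomOfRecord₁₁ F N 0 0 ∧ V ∈ sfClass 4 F.L (ne3NperOfRecord₁₁ F 0 0) ((ℓ₃ F).ε / B F) 0} :
            Set (Site 4 → Fin 4 → (MatA N)ˣ)), ∀ k : ℕ, ∃ U₀ : Site 4 → Fin 4 → (MatA N)ˣ,
          U₀ ∈ sfClass 4 F.L (ne3NperOfRecord₁₁ F 0 0) ((C F).B₃ * ((ℓ₃ F).ε / B F)) (k + 1) ∧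
            IsMinimiser 4 (sfClass 4 F.L (ne3NperOfRecord₁₁ F 0 0) (εTop F)) F.L (ne3NperOfRecord₁₁ F 0 0) (k + 1) V U₀) →
        (∀ (F : T4Family) (k : ℕ), ∀ V ∈ ({V | V ∈ ne3DomOfRecord₁₁ F N 0 0 ∧ V ∈ sfClass 4 F.L (ne3NperOfRecord₁₁ F 0 0) ((ℓ₃ F).ε / B F) 0} :
            Set (Site 4 → Fin 4 → (MatA N)ˣ)),
          ∀ U₀ : Site 4 → Fin 4 → (MatA N)ˣ,
            IsMinimiser 4 (sfClass 4 F.L (ne3NperOfRecord₁₁ F 0 0) ((C F).B₃ * ((ℓ₃ F).ε / B F))) F.L (ne3NperOfRecord₁₁ F 0 0) (k + 1) V U₀ →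
          ∀ U : Site 4 → Fin 4 → (MatA N)ˣ, U ∈ sfClass 4 F.L (ne3NperOfRecord₁₁ F 0 0) (εTop F) (k + 1) → avgIter F.L U (k + 1) = V →
            U ∈ sfClass 4 F.L (ne3NperOfRecord₁₁ F 0 0) (ℓ₃ F).ε (k + 1) →
            IsLocalMinOn (fun W : Site 4 → Fin 4 → (MatA N)ˣ => levelAction 4 F.L (ne3NperOfRecord₁₁ F 0 0) (k + 1) W)
              (admissible (sfClass 4 F.L (ne3NperOfRecord₁₁ F 0 0) (εTop F)) F.L (k + 1) V) U →
            ∃ u : Site 4 → (MatA N)ˣ, IsUnitarySite u ∧ IsPeriodicSite u ((ne3NperOfRecord₁₁ F 0 0 * F.L ^ (k + 1) : ℕ) : ℤ) ∧ gaugeAct u U₀ = U) →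
        ∀ 𝔯 : RateReading₁₃CoPH N, N16PinnedLoose 𝔯 ℓ₃ B →
          (∀ (F : T4Family) (θ : Stage13HParams F N) (hP : θ.Provisos₁₃CoPH F N) (g₀ : ℕ → ℝ) (os : List (ULoop F)) (k : ℕ),
            LeafH3sup 4 (rateCarriersOfRecord₁₃CoPH 𝔯 F θ hP g₀ os k).ne3.L (rateCarriersOfRecord₁₃CoPH 𝔯 F θ hP g₀ os k).ne3.Nper
              (rateCarriersOfRecord₁₃CoPH 𝔯 F θ hP g₀ os k).ne3.ε (rateCarriersOfRecord₁₃CoPH 𝔯 F θ hP g₀ os k).ne3.b (c' F)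
              (rateCarriersOfRecord₁₃CoPH 𝔯 F θ hP g₀ os k).ne3.dom) ∧
          (∀ (F : T4Family) (θ : Stage13HParams F N) (hP : θ.Provisos₁₃CoPH F N) (g₀ : ℕ → ℝ) (os : List (ULoop F)) (k : ℕ),
            ∃ sel : ℕ → (Site 4 → Fin 4 → (MatA N)ˣ) → (Site 4 → Fin 4 → (MatA N)ˣ),
              (∀ V ∈ (rateCarriersOfRecord₁₃CoPH 𝔯 F θ hP g₀ os k).ne3.dom, ∀ j : ℕ,
                IsMinimiser 4 (sfClass 4 (rateCarriersOfRecord₁₃CoPH 𝔯 F θ hP g₀ os k).ne3.L (rateCarriersOfRecord₁₃CoPH 𝔯 F θ hP g₀ os k).ne3.Nper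
                  (rateCarriersOfRecord₁₃CoPH 𝔯 F θ hP g₀ os k).ne3.ε) (rateCarriersOfRecord₁₃CoPH 𝔯 F θ hP g₀ os k).ne3.L
                  (rateCarriersOfRecord₁₃CoPH 𝔯 F θ hP g₀ os k).ne3.Nper j V (sel j V)) ∧
              (∀ V ∈ (rateCarriersOfRecord₁₃CoPH 𝔯 F θ hP g₀ os k).ne3.dom, ∀ j : ℕ,
                RegularSup 4 (rateCarriersOfRecord₁₃CoPH 𝔯 F θ hP g₀ os k).ne3.L (rateCarriersOfRecord₁₃CoPH 𝔯 F θ hP g₀ os k).ne3.Nper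
                  (rateCarriersOfRecord₁₃CoPH 𝔯 F θ hP g₀ os k).ne3.b (c' F) j (sel j V))) := by
  obtain ⟨ℓ₃, B, c', hEnd, hM, hF, hrows, hH, hloose, hJ⟩ :=
    exists_letters_n16HolderAtReading_loose_squeezeJunction_of_entry_reg910Slot (N := N) hβ1 hE hGm hG C hR
  refine ⟨ℓ₃, B, c', hEnd, hM, hF, hrows, hH, fun εTop hεT h8P hU6loc 𝔯 hpin => ⟨?_, ?_⟩⟩
  · exact hH3_of_pinnedLoose_of_loose_of_exists8P_locMin (ρ := fun F => (C F).B₃ * ((ℓ₃ F).ε / B F))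
      (c := fun F => 16937 * ((C F).B₃ * ((ℓ₃ F).ε / B F))) hpin hloose (fun F => (hJ F).2.1) hεT h8P hU6loc
      (fun F => (hJ F).2.2.1) (fun F => (hJ F).2.2.2.1)
  · exact hsel_of_pinnedLoose_of_loose_of_exists8P (ρ := fun F => (C F).B₃ * ((ℓ₃ F).ε / B F))
      (c := fun F => 16937 * ((C F).B₃ * ((ℓ₃ F).ε / B F))) hpin hloose (fun F => (hJ F).2.1) hεT h8P
      (fun F => (hJ F).2.2.1) (fun F => (hJ F).2.2.2.1) hM
      (fun F => ⟨(hrows F).1, (hrows F).2.1, (hrows F).2.2.1, (hrows F).2.2.2.1, (hrows F).2.2.2.2.1, (hrows F).2.2.2.2.2.1,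
        (hrows F).2.2.2.2.2.2.2.2.1, (hrows F).2.2.2.2.2.2.2.2.2⟩)

end Producer
end

end Summit.QuantumFields.YangMills.BalabanUVNodes.N16EntrySqueezeJunction
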